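import Literature.Topology.FourManifolds.GluingUniqueness
import Literature.Topology.FourManifolds.CollarShrink
import Literature.Topology.FourManifolds.CollarHeightFunction
import HarnessLib

/-!
# Push-forward by zero along an open immersion; the ramped collar height of a compact manifold
# with boundary
(helper file 1/3 of the wave-2 brick T2 "the complement piece" for stub `stub_steinRealisation`,
line `modp-braid-orbits` r11, crux `ConvexBisection.AcyclicBisectionExists`,
item stmt-SmoothPoincare4-10508; lead c4)

Generic tools for presenting the positive Lefschetz sub-handlebody `X₁ = X(F; P)` of a sorted
fibred model `M = X(F; P ++ N) ∪_Ψ Base g` as a regular superlevel set `{G ≥ c}` of a smooth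
function `G : M → ℝ` (Baykur 2006, proof of Thm. 5.1: `M = W₁ ∪ W₂` with `W₁ = X₊`; Milnor 1963,
Thm. 3.1: `M = Mᶜ ∪ f⁻¹[c, ∞)`), where `G` is a collar-height function of `X₁` pushed forward by
zero along the open immersions `X₁ ∖ ∂X₁ ↪ X ↪ M`:

* `contMDiff_extend_zero_of_isImmersionAt` — if `j : A → P` is an injective open map which is an
  immersion at every point and `g : A → ℝ` is smooth and vanishes off a set whose image is closed
  in `P`, then `Function.extend j g 0` (i.e. `g ∘ j⁻¹` on `j(A)`, `0` elsewhere) is smooth on `P`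
  (descent of smoothness along an open immersion, `contMDiffAt_of_comp_isImmersionAt`);
* `isMCriticalPt_of_comp_of_eventuallyEq` — chain rule: a critical point of `G` at `j a` is a
  critical point of any `g` agreeing with `G ∘ j` near `a`;
* `collarRamp c` — a smooth profile `ℝ → ℝ` vanishing on `(-∞, c/4]`, the identity on `[c/2, ∞)` and
  `≤ id` on `[0, ∞)`, so that `c ≤ collarRamp c s ↔ c ≤ s` and `collarRamp c s = c ↔ s = c` (`0 < c`, `0 ≤ s`);
* `helper_le_collarHeightFn_iff_mem_range_shrink` (registered) — `{c ≤ collarHeightFn D}` is the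
  range of the shrink map `D.shrink univ` (`c = CollarShrink.shrinkConst`);
* `cutHeight D = collarRamp c ∘ collarHeightFn D` for an open collar `D` of a compact `4`-manifold with
  boundary `X₁` and `c = CollarShrink.shrinkConst` (`CollarHeightFunction.lean`, `CollarShrink.lean`):
  smooth, `0` near `∂X₁`, with superlevel set `{c ≤ cutHeight} = {c ≤ collarHeightFn}` = the range
  of the shrink map `D.shrink univ` (`X₁` minus the open collar of heights `< c`, a diffeomorphic
  copy of `X₁`: Milnor 1965, §1; Kosinski 1993, VI.5), and regular along the level `{cutHeight = c}`
  (`not_isMCriticalPt_cutHeight`, from `not_isMCriticalPt_collarHeightFn`).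

Everything here is proved; no named facts.

## References
* J. Milnor, *Morse theory* (1963), §3, Thm. 3.1. [Milnor1963]
* J. Milnor, *Lectures on the h-cobordism theorem* (1965), §1, Lemma 2.9. [MilnorHCobordism1965]
* A. A. Kosinski, *Differential Manifolds* (1993), VI §1 (proof of (1.1)), VI §5. [Kosinski1993]
* R. İ. Baykur, *Kähler decomposition of 4-manifolds*, AGT 6 (2006), proof of Thm. 5.1. [Baykur2006]
-/

noncomputable section

-- the prescribed namespace `Summit.<P>.<Sub>.…` duplicates `SmoothPoincare4` (P = Sub)
set_option linter.dupNamespace false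

open scoped Manifold ContDiff Topology

namespace Summit.SmoothPoincare4.SmoothPoincare4.Theorems.AcyclicBisectionExists.ModpBraidOrbits

open Set Function Filter
open Literature.Topology.FourManifolds CollarShrink BoundaryData.OpenCollar

/-! ### Push-forward by zero along an open immersion -/

section Pushforward

/-- The push-forward by zero agrees with `g` on `j(A)` (`j` injective). [folklore] -/
theorem extend_zero_apply {A P : Type*} {j : A → P} (hj : Injective j) (g : A → ℝ) (a : A) :
    Function.extend j g 0 (j a) = g a :=
  hj.extend_apply g 0 a

/-- The push-forward by zero vanishes off `j(A)`. [folklore] -/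
theorem extend_zero_of_not_mem_range {A P : Type*} {j : A → P} (g : A → ℝ) {p : P}
    (hp : p ∉ range j) : Function.extend j g 0 p = 0 := by
  rw [Function.extend_apply' g (0 : P → ℝ) p fun ⟨a, ha⟩ => hp ⟨a, ha⟩]
  rfl

/-- Off a set `K` with `g a = 0` whenever `j a ∉ K`, the push-forward by zero vanishes.
[folklore] -/
theorem extend_zero_eq_zero_of_not_mem {A P : Type*} {j : A → P} (hj : Injective j) (g : A → ℝ)
    {K : Set P} (hgK : ∀ a, j a ∉ K → g a = 0) {p : P} (hp : p ∉ K) :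
    Function.extend j g 0 p = 0 := by
  by_cases hpj : p ∈ range j
  · obtain ⟨a, rfl⟩ := hpj
    rw [extend_zero_apply hj]
    exact hgK a hp
  · exact extend_zero_of_not_mem_range g hpj

variable {EA HA EP HP : Type*}
  [NormedAddCommGroup EA] [NormedSpace ℝ EA] [TopologicalSpace HA] {IA : ModelWithCorners ℝ EA HA}
  [NormedAddCommGroup EP] [NormedSpace ℝ EP] [TopologicalSpace HP] {IP : ModelWithCorners ℝ EP HP}
  {A : Type*} [TopologicalSpace A] [ChartedSpace HA A]
  {P : Type*} [TopologicalSpace P] [ChartedSpace HP P]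

/-- **Push-forward by zero along an open immersion is smooth.**  Let `j : A → P` be injective,
an open map and an immersion at every point (e.g. an open smooth embedding, or an equidimensional
smooth embedding restricted to the interior), and let `g : A → ℝ` be smooth with `g a = 0`
whenever `j a ∉ K`, for some closed `K ⊆ P`.  Then the function `G = Function.extend j g 0`
(`G (j a) = g a`, `G = 0` off `j(A)`) is smooth: at points of `j(A)` by descent of smoothness
along the open immersion `j` (Kosinski 1993, VI §1, proof of (1.1):
`contMDiffAt_of_comp_isImmersionAt`), and near points off `j(A) ⊇ K` it vanishes identically.
[cite: Kosinski1993, VI §1, proof of (1.1)] -/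
theorem contMDiff_extend_zero_of_isImmersionAt {j : A → P}
    (hj : ∀ a, Manifold.IsImmersionAt IA IP ∞ j a) (hjo : IsOpenMap j) (hinj : Injective j)
    {g : A → ℝ} (hg : ContMDiff IA 𝓘(ℝ, ℝ) ∞ g) {K : Set P} (hK : IsClosed K)
    (hKj : K ⊆ range j) (hgK : ∀ a, j a ∉ K → g a = 0) :
    ContMDiff IP 𝓘(ℝ, ℝ) ∞ (Function.extend j g 0) := by
  intro p
  by_cases hp : p ∈ range j
  · obtain ⟨a, rfl⟩ := hp
    exact contMDiffAt_of_comp_isImmersionAt (hj a) hjo (hg a) fun a' => extend_zero_apply hinj g a'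
  · have hpK : p ∉ K := fun h => hp (hKj h)
    have hev : Function.extend j g 0 =ᶠ[𝓝 p] fun _ => (0 : ℝ) := by
      filter_upwards [hK.isOpen_compl.mem_nhds hpK] with q hq
      exact extend_zero_eq_zero_of_not_mem hinj g hgK hq
    exact contMDiffAt_const.congr_of_eventuallyEq hev

/-- **Chain rule for critical points along a differentiable map.**  If `G ∘ j` agrees with `g`
near `a`, `j` is differentiable at `a`, `G` is differentiable at `j a` and `j a` is a critical
point of `G`, then `a` is a critical point of `g` (`d g_a = d G_{j a} ∘ d j_a = 0`).  Used
contrapositively: regular points of the collar height push forward to regular points.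
[cite: Milnor1963, §2] -/
theorem isMCriticalPt_of_comp_of_eventuallyEq {j : A → P} {G : P → ℝ} {g : A → ℝ} {a : A}
    (hj : MDifferentiableAt IA IP j a) (hG : MDifferentiableAt IP 𝓘(ℝ, ℝ) G (j a))
    (heq : (G ∘ j) =ᶠ[𝓝 a] g) (hc : IsMCriticalPt IP G (j a)) : IsMCriticalPt IA g a := by
  unfold IsMCriticalPt at hc ⊢
  rw [← heq.mfderiv_eq, mfderiv_comp a hG hj, hc, ContinuousLinearMap.zero_comp]
  rfl

end Pushforward

/-! ### The collarRamp profile -/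

section Ramp

/-- **The collarRamp profile** `collarRamp c s = χ(4s/c - 1) · s` with `χ` Mathlib's `Real.smoothTransition`:
`0` for `s ≤ c/4`, `s` for `s ≥ c/2`. [folklore] -/
def collarRamp (c s : ℝ) : ℝ := Real.smoothTransition (4 * s / c - 1) * s

/-- The collarRamp profile is smooth. [folklore] -/
theorem contDiff_collarRamp (c : ℝ) : ContDiff ℝ ∞ (collarRamp c) := by
  unfold collarRamp
  exact (Real.smoothTransition.contDiff.comp
    (((contDiff_const.mul contDiff_id).div_const c).sub contDiff_const)).mul contDiff_id

/-- The collarRamp profile vanishes on `(-∞, c/4]` (`0 < c`). [folklore] -/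
theorem collarRamp_of_le {c s : ℝ} (hc : 0 < c) (hs : s ≤ c / 4) : collarRamp c s = 0 := by
  unfold collarRamp
  rw [Real.smoothTransition.zero_of_nonpos, zero_mul]
  rw [sub_nonpos, div_le_one hc]
  linarith

/-- The collarRamp profile is the identity on `[c/2, ∞)` (`0 < c`). [folklore] -/
theorem collarRamp_of_ge {c s : ℝ} (hc : 0 < c) (hs : c / 2 ≤ s) : collarRamp c s = s := by
  unfold collarRamp
  rw [Real.smoothTransition.one_of_one_le, one_mul]
  rw [le_sub_iff_add_le, le_div_iff₀ hc]
  linarith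

/-- The collarRamp profile is at most the identity on `[0, ∞)`. [folklore] -/
theorem collarRamp_le {c s : ℝ} (hs : 0 ≤ s) : collarRamp c s ≤ s := by
  unfold collarRamp
  exact (mul_le_of_le_one_left hs (Real.smoothTransition.le_one _))

/-- The collarRamp profile is nonnegative on `[0, ∞)`. [folklore] -/
theorem collarRamp_nonneg {c s : ℝ} (hs : 0 ≤ s) : 0 ≤ collarRamp c s :=
  mul_nonneg (Real.smoothTransition.nonneg _) hs

/-- **The superlevel set `{collarRamp c ≥ c}` is `{s ≥ c}`** (`0 < c`, `0 ≤ s`). [folklore] -/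
theorem le_collarRamp_iff {c s : ℝ} (hc : 0 < c) (hs : 0 ≤ s) : c ≤ collarRamp c s ↔ c ≤ s := by
  constructor
  · intro h
    by_contra hlt
    exact absurd (h.trans (collarRamp_le hs)) hlt
  · intro h
    rw [collarRamp_of_ge hc (by linarith)]
    exact h

/-- **The level `{collarRamp c = c}` is `{s = c}`** (`0 < c`, `0 ≤ s`). [folklore] -/
theorem collarRamp_eq_iff {c s : ℝ} (hc : 0 < c) (hs : 0 ≤ s) : collarRamp c s = c ↔ s = c := by
  constructor
  · intro h
    have h1 : c ≤ s := (le_collarRamp_iff hc hs).1 h.ge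
    rwa [collarRamp_of_ge hc (by linarith)] at h
  · rintro rfl
    exact collarRamp_of_ge hc (by linarith)

/-- Near a point `s₀ > c/2` the collarRamp profile is the identity (`0 < c`). [folklore] -/
theorem collarRamp_eventuallyEq_id {c s₀ : ℝ} (hc : 0 < c) (hs₀ : c / 2 < s₀) :
    collarRamp c =ᶠ[𝓝 s₀] id := by
  filter_upwards [Ioi_mem_nhds hs₀] with s hs
  exact collarRamp_of_ge hc (le_of_lt hs)

end Ramp

/-! ### The ramped collar height on a compact manifold with boundary -/

section CutHeight

variable {X₁ : Type} [TopologicalSpace X₁] [ChartedSpace (EuclideanHalfSpace 4) X₁]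
  {b : BoundaryData (𝓡∂ 4) X₁ (𝓡 3)} (D : b.OpenCollar)

/-- `c < ½` for the shrink constant `c = 1 / (2B + 2)`, `B > 0`. [folklore] -/
theorem shrinkConst_lt_half : shrinkConst < 2⁻¹ := by
  have hB := bound_spec.1
  unfold shrinkConst
  rw [div_lt_iff₀ (by linarith), ← sub_pos]
  nlinarith

/-- `c ≤ ½` in the form used by `CollarHeightFunction.lean`. [folklore] -/
theorem shrinkConst_le_half' : shrinkConst ≤ 2⁻¹ := le_of_lt shrinkConst_lt_half

/-- The collar-height function is nonnegative. [folklore] -/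
theorem collarHeightFn_nonneg (z : X₁) : 0 ≤ D.collarHeightFn z := by
  by_contra h
  obtain ⟨x, t, ht, -⟩ := (D.collarHeightFn_lt_iff (c := 0) (by norm_num) z).1 (not_le.1 h)
  exact absurd ht.2 (not_lt.2 ht.1)

/-- The collar-height function vanishes on the boundary (the bottom of the collar). [folklore] -/
theorem collarHeightFn_eq_zero_of_mem_boundary {z : X₁} (hz : z ∈ (𝓡∂ 4).boundary X₁) :
    D.collarHeightFn z = 0 := by
  rw [← b.range_incl] at hz
  obtain ⟨y, rfl⟩ := hz
  rw [← D.apply_zero y, D.collarHeightFn_apply y le_rfl, heightProfile_of_le (by norm_num)]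

/-- A point of positive collar height is an interior point. [folklore] -/
theorem isInteriorPoint_of_collarHeightFn_pos {z : X₁} (hz : 0 < D.collarHeightFn z) :
    (𝓡∂ 4).IsInteriorPoint z :=
  ((𝓡∂ 4).isInteriorPoint_or_isBoundaryPoint z).resolve_right fun hb => by
    have hb' : z ∈ (𝓡∂ 4).boundary X₁ := hb
    rw [collarHeightFn_eq_zero_of_mem_boundary D hb'] at hz
    exact lt_irrefl 0 hz

/-- **The ramped collar height** `collarRamp c ∘ collarHeightFn`: `0` where the collar height is
`≤ c/4` (so near `∂X₁`), the collar height itself where it is `≥ c/2`.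
[cite: MilnorHCobordism1965, §1 after Thm. 1.4] -/
def cutHeight (z : X₁) : ℝ := collarRamp shrinkConst (D.collarHeightFn z)

/-- The ramped collar height vanishes where the collar height is `≤ c/4`. [folklore] -/
theorem cutHeight_eq_zero_of_le {z : X₁} (hz : D.collarHeightFn z ≤ shrinkConst / 4) :
    cutHeight D z = 0 :=
  collarRamp_of_le shrinkConst_pos hz

/-- Where the ramped collar height does not vanish, the collar height is `> c/4`. [folklore] -/
theorem lt_collarHeightFn_of_cutHeight_ne_zero {z : X₁} (hz : cutHeight D z ≠ 0) :
    shrinkConst / 4 < D.collarHeightFn z :=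
  not_le.1 fun h => hz (cutHeight_eq_zero_of_le D h)

/-- The ramped collar height vanishes on the boundary `∂X₁`. [folklore] -/
theorem cutHeight_eq_zero_of_mem_boundary {z : X₁} (hz : z ∈ (𝓡∂ 4).boundary X₁) :
    cutHeight D z = 0 := by
  apply cutHeight_eq_zero_of_le
  rw [collarHeightFn_eq_zero_of_mem_boundary D hz]
  linarith [shrinkConst_pos]

/-- A point of collar height `≥ c/4` is an interior point. [folklore] -/
theorem isInteriorPoint_of_le_collarHeightFn {z : X₁} (hz : shrinkConst / 4 ≤ D.collarHeightFn z) :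
    (𝓡∂ 4).IsInteriorPoint z :=
  isInteriorPoint_of_collarHeightFn_pos D (lt_of_lt_of_le (by linarith [shrinkConst_pos]) hz)

/-- A point where the ramped collar height does not vanish is an interior point. [folklore] -/
theorem isInteriorPoint_of_cutHeight_ne_zero {z : X₁} (hz : cutHeight D z ≠ 0) :
    (𝓡∂ 4).IsInteriorPoint z :=
  isInteriorPoint_of_le_collarHeightFn D (le_of_lt (lt_collarHeightFn_of_cutHeight_ne_zero D hz))

/-- **Superlevel set**: `c ≤ cutHeight z ↔ c ≤ collarHeightFn z`. [folklore] -/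
theorem le_cutHeight_iff (z : X₁) :
    shrinkConst ≤ cutHeight D z ↔ shrinkConst ≤ D.collarHeightFn z :=
  le_collarRamp_iff shrinkConst_pos (collarHeightFn_nonneg D z)

/-- **Level**: `cutHeight z = c ↔ collarHeightFn z = c`. [folklore] -/
theorem cutHeight_eq_iff (z : X₁) :
    cutHeight D z = shrinkConst ↔ D.collarHeightFn z = shrinkConst :=
  collarRamp_eq_iff shrinkConst_pos (collarHeightFn_nonneg D z)

/-- **The superlevel set `{c ≤ collarHeightFn}` is the range of the shrink map** (the complement
of the open collar of heights `< c`). [cite: Kosinski1993, VI §5] -/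
theorem le_collarHeightFn_iff_mem_range_shrink (z : X₁) :
    shrinkConst ≤ D.collarHeightFn z ↔ z ∈ range (D.shrink univ) := by
  constructor
  · intro h
    rcases D.mem_range_shrink_or univ z with hz | ⟨x, -, t, ht0, htc, rfl⟩
    · exact hz
    · rw [D.collarHeightFn_apply x ht0,
        heightProfile_of_le (by linarith [shrinkConst_lt_half])] at h
      exact absurd htc (not_lt.2 h)
  · intro h
    by_contra hlt
    obtain ⟨x, t, ht, rfl⟩ := (D.collarHeightFn_lt_iff shrinkConst_le_half' z).1 (not_le.1 hlt)
    exact D.toFun_not_mem_range_shrink univ (mem_univ x) ht.1 ht.2 h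


/-- **Registered helper `helper_le_collarHeightFn_iff_mem_range_shrink` (sub-goal of NF6
`stub_steinRealisation`, wave 2 brick T2, lead c4): the pushed-in copy of a manifold with boundary.**
For an open collar `D` of a boundary datum of a `4`-manifold with boundary `X₁`, the superlevel set
`{c ≤ collarHeightFn D}` of the collar-height function (`c = CollarShrink.shrinkConst`) is exactly
the range of the shrink map `D.shrink univ` (a smooth embedding `X₁ → X₁ ∖ ∂X₁`,
`CollarShrink.isSmoothEmbedding_shrinkTo`): "`W ≅ W ∖ (open collar)`", Milnor (1965), §1;
Kosinski (1993), VI.5. [cite: Kosinski1993, VI §5] -/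
theorem helper_le_collarHeightFn_iff_mem_range_shrink :
    ∀ (X₁ : Type) [TopologicalSpace X₁] [ChartedSpace (EuclideanHalfSpace 4) X₁]
      (b : BoundaryData (𝓡∂ 4) X₁ (𝓡 3)) (D : b.OpenCollar) (z : X₁),
      CollarShrink.shrinkConst ≤ D.collarHeightFn z ↔ z ∈ Set.range (D.shrink Set.univ) :=
  fun _ _ _ _ D z => le_collarHeightFn_iff_mem_range_shrink D z

variable [T2Space X₁] [CompactSpace X₁] [IsManifold (𝓡∂ 4) ∞ X₁]

/-- The ramped collar height is smooth. [folklore] -/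
theorem contMDiff_cutHeight : ContMDiff (𝓡∂ 4) 𝓘(ℝ, ℝ) ∞ (cutHeight D) := by
  haveI : CompactSpace b.carrier := b.compactSpace_carrier
  exact (contDiff_collarRamp shrinkConst).comp_contMDiff D.contMDiff_collarHeightFn

/-- The ramped collar height is continuous. [folklore] -/
theorem continuous_cutHeight : Continuous (cutHeight D) := (contMDiff_cutHeight D).continuous

/-- Near a point of the level `{cutHeight = c}` the ramped collar height is the collar height.
[folklore] -/
theorem cutHeight_eventuallyEq {z : X₁} (hz : cutHeight D z = shrinkConst) :
    cutHeight D =ᶠ[𝓝 z] D.collarHeightFn := by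
  haveI : CompactSpace b.carrier := b.compactSpace_carrier
  have hzc : D.collarHeightFn z = shrinkConst := (cutHeight_eq_iff D z).1 hz
  have hlt : shrinkConst / 2 < D.collarHeightFn z := by rw [hzc]; linarith [shrinkConst_pos]
  filter_upwards [(isOpen_lt continuous_const D.continuous_collarHeightFn).mem_nhds hlt] with y hy
  exact collarRamp_of_ge shrinkConst_pos (le_of_lt hy)

/-- **The level `{cutHeight = c}` consists of regular points** (the collar height has no critical
point at heights in `(0, ½)`, `not_isMCriticalPt_collarHeightFn`).
[cite: MilnorHCobordism1965, Lemma 2.9] -/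
theorem not_isMCriticalPt_cutHeight {z : X₁} (hz : cutHeight D z = shrinkConst) :
    ¬ IsMCriticalPt (𝓡∂ 4) (cutHeight D) z := by
  have hzc : D.collarHeightFn z = shrinkConst := (cutHeight_eq_iff D z).1 hz
  obtain ⟨x, rfl⟩ := (D.collarHeightFn_eq_iff shrinkConst_pos shrinkConst_le_half' z).1 hzc
  have hreg := D.not_isMCriticalPt_collarHeightFn (D.mem_region x _ shrinkConst_pos.le)
    (by rw [D.height_apply x _ shrinkConst_pos.le]; exact shrinkConst_pos)
    (by rw [D.height_apply x _ shrinkConst_pos.le]; exact shrinkConst_lt_half)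
  intro hc
  apply hreg
  unfold IsMCriticalPt at hc ⊢
  rwa [← (cutHeight_eventuallyEq D hz).mfderiv_eq]

/-- The set `{c/4 ≤ collarHeightFn}` (outside which `cutHeight` vanishes) is compact. [folklore] -/
theorem isCompact_cutSupport : IsCompact {z : X₁ | shrinkConst / 4 ≤ D.collarHeightFn z} := by
  haveI : CompactSpace b.carrier := b.compactSpace_carrier
  exact (isClosed_le continuous_const D.continuous_collarHeightFn).isCompact

end CutHeight

end Summit.SmoothPoincare4.SmoothPoincare4.Theorems.AcyclicBisectionExists.ModpBraidOrbits

end
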